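import Mathlib
import HarnessLib
import Summits.KontsevichZagierPeriods.KontsevichZagierPeriods.Theses.LinRedNormalForm
import Summits.KontsevichZagierPeriods.KontsevichZagierPeriods.Theorems.LinRedNormalFormDihedralNormalFormStubTorusDescent
import Summits.KontsevichZagierPeriods.KontsevichZagierPeriods.Theorems.LinRedNormalFormDihedralNormalFormStubWordAtomChart
import Summits.KontsevichZagierPeriods.KontsevichZagierPeriods.Theorems.LinRedNormalFormDihedralNormalFormStubAtomReduction
import Summits.KontsevichZagierPeriods.KontsevichZagierPeriods.Theorems.LinRedNormalFormDihedralNormalFormStubRebaseOne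
import Summits.KontsevichZagierPeriods.KontsevichZagierPeriods.Theorems.LinRedNormalFormDihedralNormalFormStubUnnestingThree
import Summits.KontsevichZagierPeriods.KontsevichZagierPeriods.Theorems.LinRedNormalFormDihedralNormalFormStubNestedReduction
import Summits.KontsevichZagierPeriods.KontsevichZagierPeriods.Theorems.LinRedNormalFormDihedralNormalFormStubProductClosure
import Summits.KontsevichZagierPeriods.KontsevichZagierPeriods.Theorems.LinRedNormalFormDihedralNormalFormStubMonomialConvergence
import Summits.KontsevichZagierPeriods.KontsevichZagierPeriods.Theorems.LinRedNormalFormDihedralNormalFormStubChartBack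
import Summits.KontsevichZagierPeriods.KontsevichZagierPeriods.Theorems.LinRedNormalFormDihedralNormalFormStubSimplexProductSplit
import Summits.KontsevichZagierPeriods.KontsevichZagierPeriods.Theorems.LinRedNormalFormDihedralNormalFormStubDilationNL
import Summits.KontsevichZagierPeriods.KontsevichZagierPeriods.Theorems.LinRedNormalFormDihedralNormalFormStubDeRhamAux1
import Summits.KontsevichZagierPeriods.KontsevichZagierPeriods.Theorems.LinRedNormalFormDihedralNormalFormClosedFormSplit

/-!
# Line `torus-descent-sum-shadow` — skeleton v6 for crux `DihedralNormalForm` (stmt-KontsevichZagierPeriods-3912)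

Lead a2, 2026-08-17.  v5 (lead c1) reduced the crux to ONE residual stub, `stub_unnestingHigh`
(unnesting of non-nested non-product convergent cubical atoms in dimension `k ≥ 4`), on which three
lines died: with the relation supplies of those lines (1b, dihedral symmetry, cubical-axis
Newton–Leibniz, torus descents, product maps) the residual is the word+product surjectivity of
cell-zeta values.  Lead a1 then exhibited a LEGAL relation family that none of them had — vertex
splitting, the face terms of a translation-closed rational form one dimension up (landed move
schemas `VertexSplitting.nl_axis_osimplex`, `VertexSplitting.vertexSplit`, p125009) — and exact
linear algebra showing that {1b, dihedral, Euler, vertex splitting, words} kills the complete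
convergent log sector of `M_{0,7}` and `M_{0,8}`.  Vertex splitting lives on the ordered SIMPLEX
(it moves one braid letter `tᵢ - tⱼ`), not on the cube.

## Reshape (v6): the residual is moved to the simplex and split into analytic schemas + engine

* `stub_chartBack` (NEW, M): a convergent cubical atom is congruent (one rule-2 move, the chart
  `tᵢ = x₀⋯xᵢ`) to a convergent SIMPLICIAL LAURENT MONOMIAL representation
  `[Δ_k, q·∏ tᵢ^{βᵢ} (1-tᵢ)^{γᵢ} ∏_{i<j} (tᵢ-tⱼ)^{αᵢⱼ}]`, exponents in `ℤ`
  (inverse direction of the landed `stub_atomReduction`/`stub_wordAtomChart`).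
* `stub_simplexProductSplit` (NEW, M): a simplicial monomial none of whose forms crosses a seam
  (`γⱼ = 0` for the small variables `j ≥ p`, `αᵢⱼ = 0` for `i + 1 < p ≤ j`) is congruent to the
  product `KZ.of s₁ * KZ.of s₂` of two simplicial monomial representations of dimensions `p`,
  `k - p` (dilation chart `u = t_{≥p}/t_{p-1}` + Fubini; pattern `stub_productSplit` p120401).
* `stub_monomialConvergence` (NEW, L): Brown's convergence criterion on the simplex — the three
  families of consecutive-block inequalities imply absolute integrability of a simplicial Laurent
  monomial on `Δ_k` (simplicial counterpart of the landed cubical `atomConvergence` p101808).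
* `stub_dilationNL` (NEW, M): the Euler / dilation Newton–Leibniz move on the simplex: dilating
  the small variables `t_{≥m}` gives `[Δ_{k+1}, (D + #scaled)·F] ≡ [Δ_k, (t_m F)|_{t_m → t_{m-1}}]`
  (explicit bulk for a monomial `F`; the lower face vanishes) — the cubical-axis move
  (`Nested.atomAxisNL`) read on the simplex.
* `stub_engine` (THE RESIDUAL, held by the lead): GIVEN the two schemas above (verbatim, as
  hypotheses) and the landed vertex-splitting schemas, every convergent simplicial Laurent monomial
  representation of dimension `k ≥ 4` is congruent modulo `KZ.relations` to a `ℤ`-combination of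
  MZV word representations, simplicial product monomials of dimension `k`, and convergent simplicial
  monomials of dimension `< k`.
The composition below is sorry-free: `stub_atomReduction` (landed) turns the crux's input into
cubical atoms, `stub_chartBack` turns atoms into simplicial monomials, `smono_red` (strong induction
on the dimension: `k ≤ 3` through the LANDED cubical chain — Theorem N, torus descent, re-cubing,
unnesting in dimension ≤ 3, product split, word chart —, `k ≥ 4` through `stub_engine`,
`stub_simplexProductSplit`, `stub_productClosure` and the induction hypothesis) turns them into words.
`stub_productSplit` (v5, landed p120401) is no longer needed by the composition (in dimension ≤ 3 the
unnesting stub digests product atoms); it stays a landed support of the item.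
-/

noncomputable section

set_option linter.dupNamespace false

open MeasureTheory Set

namespace Summit.KontsevichZagierPeriods.KontsevichZagierPeriods.Cruxes.DihedralNormalForm.TorusDescent

open Literature.NumberTheory.Transcendental
open Summit.KontsevichZagierPeriods.DihedralNormalForm.TorusDescent (stub_torusDescent stub_wordAtomChart stub_atomReduction stub_rebaseOne stub_unnesting_le_three stub_nestedReduction stub_monomialConvergence stub_chartBack stub_simplexProductSplit stub_dilationNL)
open Summit.KontsevichZagierPeriods.DihedralNormalForm.TameBVStokes (stub_productClosure)

/-! ## The generator sets (cubical, as in v5) -/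

/-- The crux's target generators: MZV word representations `[Δ_w, q · ∏ ω_{εᵢ}(tᵢ)]`. -/
abbrev WordRep : Set KZ.FormalRep :=
  {x : Literature.NumberTheory.Transcendental.KZ.FormalRep | ∃ (w : ℕ) (ε : Fin w → Bool) (q : ℚ) (s : Literature.NumberTheory.Transcendental.KZ.IntegralRep w), s.domain = {t | (∀ i, 0 < t i) ∧ (∀ i, t i < 1) ∧ StrictAnti t} ∧ Set.EqOn s.integrand (fun t => (q : ℝ) * ∏ i, if ε i then 1 / (1 - t i) else 1 / t i) s.domain ∧ x = Literature.NumberTheory.Transcendental.KZ.of s}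

/-- Cubical atoms of dimension `k`. -/
abbrev Atom (k : ℕ) : Set KZ.FormalRep :=
  {z : Literature.NumberTheory.Transcendental.KZ.FormalRep | ∃ (q : ℚ) (a : Fin k → ℕ) (e : Fin k → Fin k → ℤ) (s : Literature.NumberTheory.Transcendental.KZ.IntegralRep k), s.domain = {x : Fin k → ℝ | ∀ i, x i ∈ Set.Ioo (0:ℝ) 1} ∧ Set.EqOn s.integrand (fun x => (q : ℝ) * ((∏ i : Fin k, x i ^ a i) * ∏ i : Fin k, ∏ j : Fin k, if i ≤ j then (1 - (∏ l : Fin k, if i ≤ l ∧ l ≤ j then x l else 1)) ^ e i j else 1)) s.domain ∧ z = Literature.NumberTheory.Transcendental.KZ.of s}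

/-- Atoms of dimension `< k`. -/
abbrev AtomLT (k : ℕ) : Set KZ.FormalRep :=
  {z : Literature.NumberTheory.Transcendental.KZ.FormalRep | ∃ d : ℕ, d < k ∧ z ∈ {z : Literature.NumberTheory.Transcendental.KZ.FormalRep | ∃ (q : ℚ) (a : Fin d → ℕ) (e : Fin d → Fin d → ℤ) (s : Literature.NumberTheory.Transcendental.KZ.IntegralRep d), s.domain = {x : Fin d → ℝ | ∀ i, x i ∈ Set.Ioo (0:ℝ) 1} ∧ Set.EqOn s.integrand (fun x => (q : ℝ) * ((∏ i : Fin d, x i ^ a i) * ∏ i : Fin d, ∏ j : Fin d, if i ≤ j then (1 - (∏ l : Fin d, if i ≤ l ∧ l ≤ j then x l else 1)) ^ e i j else 1)) s.domain ∧ z = Literature.NumberTheory.Transcendental.KZ.of s}}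

/-- Atoms of dimension `≤ k`. -/
abbrev AtomLE (k : ℕ) : Set KZ.FormalRep :=
  {z : Literature.NumberTheory.Transcendental.KZ.FormalRep | ∃ d : ℕ, d ≤ k ∧ z ∈ {z : Literature.NumberTheory.Transcendental.KZ.FormalRep | ∃ (q : ℚ) (a : Fin d → ℕ) (e : Fin d → Fin d → ℤ) (s : Literature.NumberTheory.Transcendental.KZ.IntegralRep d), s.domain = {x : Fin d → ℝ | ∀ i, x i ∈ Set.Ioo (0:ℝ) 1} ∧ Set.EqOn s.integrand (fun x => (q : ℝ) * ((∏ i : Fin d, x i ^ a i) * ∏ i : Fin d, ∏ j : Fin d, if i ≤ j then (1 - (∏ l : Fin d, if i ≤ l ∧ l ≤ j then x l else 1)) ^ e i j else 1)) s.domain ∧ z = Literature.NumberTheory.Transcendental.KZ.of s}}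

/-- Atoms with an `SD1` descent direction. -/
abbrev SD1Atom (k : ℕ) : Set KZ.FormalRep :=
  {z : Literature.NumberTheory.Transcendental.KZ.FormalRep | ∃ (q : ℚ) (a : Fin k → ℕ) (e : Fin k → Fin k → ℤ) (s : Literature.NumberTheory.Transcendental.KZ.IntegralRep k), (∃ lam : Fin k → ℤ, (∀ l : Fin k, lam l = 0 ∨ lam l = 1 ∨ lam l = -1) ∧ (∃ p : Fin k, lam p = -1) ∧ (Finset.univ.filter (fun l : Fin k => lam l = 1)).card ≤ 1 ∧ (∀ i j : Fin k, i ≤ j → e i j ≠ 0 → (∑ l : Fin k, if i ≤ l ∧ l ≤ j then lam l else 0) = 0) ∧ (∑ l : Fin k, lam l * ((a l : ℤ) + 1)) ≠ 0) ∧ s.domain = {x : Fin k → ℝ | ∀ i, x i ∈ Set.Ioo (0:ℝ) 1} ∧ Set.EqOn s.integrand (fun x => (q : ℝ) * ((∏ i : Fin k, x i ^ a i) * ∏ i : Fin k, ∏ j : Fin k, if i ≤ j then (1 - (∏ l : Fin k, if i ≤ l ∧ l ≤ j then x l else 1)) ^ e i j else 1)) s.domain ∧ z = Literature.NumberTheory.Transcendental.KZ.of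 s}

/-- NESTED atoms. -/
abbrev NAtom (k : ℕ) : Set KZ.FormalRep :=
  {z : Literature.NumberTheory.Transcendental.KZ.FormalRep | ∃ (q : ℚ) (a : Fin k → ℕ) (e : Fin k → Fin k → ℤ) (s : Literature.NumberTheory.Transcendental.KZ.IntegralRep k), (∀ i j i' j' : Fin k, i < j → i' < j' → e i j ≠ 0 → e i' j' ≠ 0 → (i ≤ i' ∧ j' ≤ j) ∨ (i' ≤ i ∧ j ≤ j')) ∧ s.domain = {x : Fin k → ℝ | ∀ i, x i ∈ Set.Ioo (0:ℝ) 1} ∧ Set.EqOn s.integrand (fun x => (q : ℝ) * ((∏ i : Fin k, x i ^ a i) * ∏ i : Fin k, ∏ j : Fin k, if i ≤ j then (1 - (∏ l : Fin k, if i ≤ l ∧ l ≤ j then x l else 1)) ^ e i j else 1)) s.domain ∧ z = Literature.NumberTheory.Transcendental.KZ.of s}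

/-- Word atoms. -/
abbrev WAtom (k : ℕ) : Set KZ.FormalRep :=
  {z : Literature.NumberTheory.Transcendental.KZ.FormalRep | ∃ (q : ℚ) (ε : Fin k → Bool) (s : Literature.NumberTheory.Transcendental.KZ.IntegralRep k), s.domain = {x : Fin k → ℝ | ∀ i, x i ∈ Set.Ioo (0:ℝ) 1} ∧ Set.EqOn s.integrand (fun x => (q : ℝ) * ((∏ i : Fin k, x i ^ (k - 1 - (i : ℕ))) * ∏ i : Fin k, if ε i then 1 / (1 - (∏ l : Fin k, if l ≤ i then x l else 1)) else 1 / (∏ l : Fin k, if l ≤ i then x l else 1))) s.domain ∧ z = Literature.NumberTheory.Transcendental.KZ.of s}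

/-! ## The generator sets (simplicial, NEW in v6) -/

/-- Convergent SIMPLICIAL LAURENT MONOMIAL representations of dimension `k`:
`[Δ_k, q · ∏ tᵢ^{βᵢ} (1 - tᵢ)^{γᵢ} ∏_{i<j} (tᵢ - tⱼ)^{αᵢⱼ}]`, exponents in `ℤ`
(`Δ_k = {1 > t₀ > ⋯ > t_{k-1} > 0}`; convergence is carried by the representation). -/
abbrev SMono (k : ℕ) : Set KZ.FormalRep :=
  {z : Literature.NumberTheory.Transcendental.KZ.FormalRep | ∃ (q : ℚ) (β γ : Fin k → ℤ) (α : Fin k → Fin k → ℤ) (s : Literature.NumberTheory.Transcendental.KZ.IntegralRep k), s.domain = {t : Fin k → ℝ | (∀ i, 0 < t i) ∧ (∀ i, t i < 1) ∧ StrictAnti t} ∧ Set.EqOn s.integrand (fun t => (q : ℝ) * ((∏ i : Fin k, t i ^ β i) * (∏ i : Fin k, (1 - t i) ^ γ i) * ∏ i : Fin k, ∏ j : Fin k, if i < j then (t i - t j) ^ α i j else 1)) s.domain ∧ z = Literature.NumberTheory.Transcendental.KZ.of s}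

/-- Simplicial monomials of dimension `< k`. -/
abbrev SMonoLT (k : ℕ) : Set KZ.FormalRep :=
  {z : Literature.NumberTheory.Transcendental.KZ.FormalRep | ∃ d : ℕ, d < k ∧ z ∈ {z : Literature.NumberTheory.Transcendental.KZ.FormalRep | ∃ (q : ℚ) (β γ : Fin d → ℤ) (α : Fin d → Fin d → ℤ) (s : Literature.NumberTheory.Transcendental.KZ.IntegralRep d), s.domain = {t : Fin d → ℝ | (∀ i, 0 < t i) ∧ (∀ i, t i < 1) ∧ StrictAnti t} ∧ Set.EqOn s.integrand (fun t => (q : ℝ) * ((∏ i : Fin d, t i ^ β i) * (∏ i : Fin d, (1 - t i) ^ γ i) * ∏ i : Fin d, ∏ j : Fin d, if i < j then (t i - t j) ^ α i j else 1)) s.domain ∧ z = Literature.NumberTheory.Transcendental.KZ.of s}}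

/-- Simplicial PRODUCT monomials of dimension `k`: for some seam `0 < p < k` the small variables
`t_p > ⋯ > t_{k-1}` carry no letter `1` and meet the large ones only through `t_{p-1}`. -/
abbrev SProd (k : ℕ) : Set KZ.FormalRep :=
  {z : Literature.NumberTheory.Transcendental.KZ.FormalRep | ∃ (q : ℚ) (β γ : Fin k → ℤ) (α : Fin k → Fin k → ℤ) (s : Literature.NumberTheory.Transcendental.KZ.IntegralRep k), (∃ p : ℕ, 0 < p ∧ p < k ∧ (∀ i : Fin k, p ≤ (i : ℕ) → γ i = 0) ∧ (∀ i j : Fin k, (i : ℕ) + 1 < p → p ≤ (j : ℕ) → α i j = 0)) ∧ s.domain = {t : Fin k → ℝ | (∀ i, 0 < t i) ∧ (∀ i, t i < 1) ∧ StrictAnti t} ∧ Set.EqOn s.integrand (fun t => (q : ℝ) * ((∏ i : Fin k, t i ^ β i) * (∏ i : Fin k, (1 - t i) ^ γ i) * ∏ i : Fin k, ∏ j : Fin k, if i < j then (t i - t j) ^ α i j else 1)) s.domain ∧ z = Literature.NumberTheory.Transcendental.KZ.of s}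

/-- The simplicial LOG WINDOW of dimension `k`: convergent simplicial monomials all of whose exponents are `0`
or `-1`, with exactly `k` poles (total degree `-k`).  By Brown–Carr–Schneps these span `H^{k}(M^δ_{0,k+3})`;
the lab (EngineNotes-a2.md) confirms that exactness relations reduce every convergent monomial to this window
at `k = 3, 4`. -/
abbrev SLog (k : ℕ) : Set KZ.FormalRep :=
  {z : Literature.NumberTheory.Transcendental.KZ.FormalRep | ∃ (q : ℚ) (β γ : Fin k → ℤ) (α : Fin k → Fin k → ℤ) (s : Literature.NumberTheory.Transcendental.KZ.IntegralRep k), ((∀ i : Fin k, β i = 0 ∨ β i = -1) ∧ (∀ i : Fin k, γ i = 0 ∨ γ i = -1) ∧ (∀ i j : Fin k, α i j = 0 ∨ α i j = -1) ∧ (∑ i : Fin k, β i) + (∑ i : Fin k, γ i) + (∑ i : Fin k, ∑ j : Fin k, if i < j then α i j else 0) = -(k : ℤ)) ∧ s.domain = {t : Fin k → ℝ | (∀ i, 0 < t i) ∧ (∀ i, t i < 1) ∧ StrictAnti t} ∧ Set.EqOn s.integrand (fun t => (q : ℝ) * ((∏ i : Fin k, t i ^ β i) * (∏ i : Fin k,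 (1 - t i) ^ γ i) * ∏ i : Fin k, ∏ j : Fin k, if i < j then (t i - t j) ^ α i j else 1)) s.domain ∧ z = Literature.NumberTheory.Transcendental.KZ.of s}

/-! ## Registered stubs (v7.1: `stub_deRham`, `stub_logCore`; the analytic schemas are all landed) -/

-- `stub_chartBack` LANDED (p137917, …Theorems.LinRedNormalFormDihedralNormalFormStubChartBack) and is imported.

-- `stub_simplexProductSplit` LANDED (p138568, …Theorems.LinRedNormalFormDihedralNormalFormStubSimplexProductSplit; tools p138286 …Aux1) and is imported.

-- `stub_monomialConvergence` LANDED (p137542, …Theorems.LinRedNormalFormDihedralNormalFormStubMonomialConvergence) and is imported.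

-- `stub_dilationNL` LANDED (…Theorems.LinRedNormalFormDihedralNormalFormStubDilationNL, + Aux1–4) and is imported;
-- it is passed by name to `stub_deRham` / `stub_logCore` below, whose first hypothesis is its statement.

/-- **stub_deRham** (THE ANALYTIC HALF OF THE RESIDUAL, v7; "(F_k)").  EFFECTIVE CONVERGENT DE RHAM
REDUCTION on the simplex: given the dilation move (`stub_dilationNL`, verbatim) — the translation move
`VertexSplitting.nl_axis_osimplex`, `closedFormSplit`, Brown's criterion `stub_monomialConvergence` and
the dihedral symmetries being landed —, every convergent simplicial Laurent monomial representation of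
dimension `k ≥ 4` is congruent modulo `KZ.relations` to a `ℤ`-combination of LOG-WINDOW representations
(all exponents `0/−1`, exactly `k` poles), simplicial product monomials of dimension `k` and convergent
simplicial monomials of dimension `< k`.  Mechanism: Newton–Leibniz along simplicial and dilation axes with
Laurent-monomial primitives lowers pole orders and numerator degrees (integration by parts = Brown ENS 2009
Prop. 8.1 for RATIONAL primitives: the polar part of a primitive of a convergent form is closed and can be
dropped chart by chart); faces are of lower dimension.  Evidence: exhaustive on the windows (4,1), (5,2) at
`k = 3` and (5,1) at `k = 4` (lab run_Fk.py: 0 survivors).  [cite: BrownENS2009, Prop 8.1] -/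
theorem stub_deRham : (∀ (k : ℕ) (m : Fin (k + 1)) (q : ℚ) (β γ : Fin (k + 1) → ℤ) (α : Fin (k + 1) → Fin (k + 1) → ℤ) (R : Literature.NumberTheory.Transcendental.KZ.IntegralRep (k + 1)) (rb : Literature.NumberTheory.Transcendental.KZ.IntegralRep k), R.domain = {t : Fin (k + 1) → ℝ | (∀ i, 0 < t i) ∧ (∀ i, t i < 1) ∧ StrictAnti t} → Set.EqOn R.integrand (fun t => ((q : ℝ) * ((∏ i : Fin (k + 1), t i ^ β i) * (∏ i : Fin (k + 1), (1 - t i) ^ γ i) * ∏ i : Fin (k + 1), ∏ j : Fin (k + 1), if i < j then (t i - t j) ^ α i j else 1)) * ((((k : ℝ) + 1 - (m : ℝ)) + (∑ j : Fin (k + 1), if m ≤ j then (β j : ℝ) else 0) + (∑ i : Fin (k + 1), ∑ j : Fin (k + 1), if m ≤ i ∧ i < j then (α i j : ℝ) else 0)) + (∑ i : Fin (k + 1), ∑ j : Fin (k + 1), if i < m ∧ m ≤ j then (α i j : ℝ) * (-t j) / (t i - t j) else 0) + (∑ j : Fin (k + 1), if m ≤ j then (γ j : ℝ) * (-t j) /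 (1 - t j) else 0))) R.domain → rb.domain = {t : Fin k → ℝ | (∀ i, 0 < t i) ∧ (∀ i, t i < 1) ∧ StrictAnti t} → Set.EqOn rb.integrand (fun y => (if h : 0 < (m : ℕ) then y ⟨(m : ℕ) - 1, by omega⟩ else 1) * ((q : ℝ) * ((∏ i : Fin (k + 1), (Fin.insertNth m (if h : 0 < (m : ℕ) then y ⟨(m : ℕ) - 1, by omega⟩ else 1) y : Fin (k + 1) → ℝ) i ^ β i) * (∏ i : Fin (k + 1), (1 - (Fin.insertNth m (if h : 0 < (m : ℕ) then y ⟨(m : ℕ) - 1, by omega⟩ else 1) y : Fin (k + 1) → ℝ) i) ^ γ i) * ∏ i : Fin (k + 1), ∏ j : Fin (k + 1), if i < j then ((Fin.insertNth m (if h : 0 < (m : ℕ) then y ⟨(m : ℕ) - 1, by omega⟩ else 1) y : Fin (k + 1) → ℝ) i - (Fin.insertNth m (if h : 0 < (m : ℕ) then y ⟨(m : ℕ) - 1, by omega⟩ else 1) y : Fin (k + 1) → ℝ) j) ^ α i j else 1))) rb.domain → (if h : 0 < (m : ℕ) then 0 ≤ α ⟨(m : ℕ) - 1, by omega⟩ m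 else 0 ≤ γ m) → 0 < ((k : ℤ) + 1 - (m : ℤ)) + (∑ j : Fin (k + 1), if m ≤ j then β j else 0) + (∑ i : Fin (k + 1), ∑ j : Fin (k + 1), if m ≤ i ∧ i < j then α i j else 0) → Literature.NumberTheory.Transcendental.KZ.of R - Literature.NumberTheory.Transcendental.KZ.of rb ∈ Literature.NumberTheory.Transcendental.KZ.relations) → ∀ (k : ℕ) (q : ℚ) (β γ : Fin k → ℤ) (α : Fin k → Fin k → ℤ) (s : Literature.NumberTheory.Transcendental.KZ.IntegralRep k), 4 ≤ k → s.domain = {t : Fin k → ℝ | (∀ i, 0 < t i) ∧ (∀ i, t i < 1) ∧ StrictAnti t} → Set.EqOn s.integrand (fun t => (q : ℝ) * ((∏ i : Fin k, t i ^ β i) * (∏ i : Fin k, (1 - t i) ^ γ i) * ∏ i : Fin k, ∏ j : Fin k, if i < j then (t i - t j) ^ α i j else 1)) s.domain → ∃ m ∈ AddSubgroup.closure ({z : Literature.NumberTheory.Transcendental.KZ.FormalRep | ∃ (q : ℚ) (β γ : Fin k → ℤ) (α : Fin k → Fin k → ℤ) (s : Literature.NumberTheory.Transcendental.KZ.IntegralRep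 k), ((∀ i : Fin k, β i = 0 ∨ β i = -1) ∧ (∀ i : Fin k, γ i = 0 ∨ γ i = -1) ∧ (∀ i j : Fin k, α i j = 0 ∨ α i j = -1) ∧ (∑ i : Fin k, β i) + (∑ i : Fin k, γ i) + (∑ i : Fin k, ∑ j : Fin k, if i < j then α i j else 0) = -(k : ℤ)) ∧ s.domain = {t : Fin k → ℝ | (∀ i, 0 < t i) ∧ (∀ i, t i < 1) ∧ StrictAnti t} ∧ Set.EqOn s.integrand (fun t => (q : ℝ) * ((∏ i : Fin k, t i ^ β i) * (∏ i : Fin k, (1 - t i) ^ γ i) * ∏ i : Fin k, ∏ j : Fin k, if i < j then (t i - t j) ^ α i j else 1)) s.domain ∧ z = Literature.NumberTheory.Transcendental.KZ.of s} ∪ {z : Literature.NumberTheory.Transcendental.KZ.FormalRep | ∃ (q : ℚ) (β γ : Fin k → ℤ) (α : Fin k → Fin k → ℤ) (s : Literature.NumberTheory.Transcendental.KZ.IntegralRep k), (∃ p : ℕ, 0 < p ∧ p < k ∧ (∀ i : Fin k, p ≤ (i : ℕ) → γ i = 0) ∧ (∀ i j : Fin k, (i : ℕ) + 1 < p → p ≤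 (j : ℕ) → α i j = 0)) ∧ s.domain = {t : Fin k → ℝ | (∀ i, 0 < t i) ∧ (∀ i, t i < 1) ∧ StrictAnti t} ∧ Set.EqOn s.integrand (fun t => (q : ℝ) * ((∏ i : Fin k, t i ^ β i) * (∏ i : Fin k, (1 - t i) ^ γ i) * ∏ i : Fin k, ∏ j : Fin k, if i < j then (t i - t j) ^ α i j else 1)) s.domain ∧ z = Literature.NumberTheory.Transcendental.KZ.of s} ∪ {z : Literature.NumberTheory.Transcendental.KZ.FormalRep | ∃ d : ℕ, d < k ∧ z ∈ {z : Literature.NumberTheory.Transcendental.KZ.FormalRep | ∃ (q : ℚ) (β γ : Fin d → ℤ) (α : Fin d → Fin d → ℤ) (s : Literature.NumberTheory.Transcendental.KZ.IntegralRep d), s.domain = {t : Fin d → ℝ | (∀ i, 0 < t i) ∧ (∀ i, t i < 1) ∧ StrictAnti t} ∧ Set.EqOn s.integrand (fun t => (q : ℝ) * ((∏ i : Fin d, t i ^ β i) * (∏ i : Fin d, (1 - t i) ^ γ i) * ∏ i : Fin d, ∏ j : Fin d, if i < j then (t i - t j) ^ α i j else 1)) s.domain ∧ z = Literature.NumberTheory.Transcendental.KZ.of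 s}}), Literature.NumberTheory.Transcendental.KZ.of s - m ∈ Literature.NumberTheory.Transcendental.KZ.relations  := by
  sorry

/-- **stub_logCore** (THE COMBINATORIAL HALF OF THE RESIDUAL, v7; "(C_n)", held by the lead).  Given the
dilation move (`stub_dilationNL`, verbatim) and the landed schemas, every convergent LOG-WINDOW
representation of dimension `k ≥ 4` (exponents `0/−1`, `k` poles) is congruent modulo `KZ.relations` to a
`ℤ`-combination of MZV word representations, simplicial product monomials of dimension `k` and convergent
simplicial monomials of dimension `< k`.  For each `k` this is a FINITE statement (169 classes at `k = 4`,
2918 at `k = 5`); exact linear algebra over legal instances of {exactness, closed Arnold forms from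
dimension `k+1`, dihedral symmetry} proves it at `k = 4` (even without dihedral symmetry) and lead a1's at
`k = 5`; for all `k` it is CLAIM(n) of `EngineNotes-a2.md` §5 / `PROMOTE-a2.md` (a statement about
`H^{n-3}(M^δ_{0,n})`, Dupont–Vallette 2017, under the face maps from `M^δ_{0,n+1}`).
[cite: BrownENS2009, Thm 1.1; DupontVallette2017, Thm B] -/
theorem stub_logCore : (∀ (k : ℕ) (m : Fin (k + 1)) (q : ℚ) (β γ : Fin (k + 1) → ℤ) (α : Fin (k + 1) → Fin (k + 1) → ℤ) (R : Literature.NumberTheory.Transcendental.KZ.IntegralRep (k + 1)) (rb : Literature.NumberTheory.Transcendental.KZ.IntegralRep k), R.domain = {t : Fin (k + 1) → ℝ | (∀ i, 0 < t i) ∧ (∀ i, t i < 1) ∧ StrictAnti t} → Set.EqOn R.integrand (fun t => ((q : ℝ) * ((∏ i : Fin (k + 1), t i ^ β i) * (∏ i : Fin (k + 1), (1 - t i) ^ γ i) * ∏ i : Fin (k + 1), ∏ j : Fin (k + 1), if i < j then (t i - t j) ^ α i j else 1)) * ((((k : ℝ) + 1 - (m : ℝ)) + (∑ j : Fin (k +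 1), if m ≤ j then (β j : ℝ) else 0) + (∑ i : Fin (k + 1), ∑ j : Fin (k + 1), if m ≤ i ∧ i < j then (α i j : ℝ) else 0)) + (∑ i : Fin (k + 1), ∑ j : Fin (k + 1), if i < m ∧ m ≤ j then (α i j : ℝ) * (-t j) / (t i - t j) else 0) + (∑ j : Fin (k + 1), if m ≤ j then (γ j : ℝ) * (-t j) / (1 - t j) else 0))) R.domain → rb.domain = {t : Fin k → ℝ | (∀ i, 0 < t i) ∧ (∀ i, t i < 1) ∧ StrictAnti t} → Set.EqOn rb.integrand (fun y => (if h : 0 < (m : ℕ) then y ⟨(m : ℕ) - 1, by omega⟩ else 1) * ((q : ℝ) * ((∏ i : Fin (k + 1), (Fin.insertNth m (if h : 0 < (m : ℕ) then y ⟨(m : ℕ) - 1, by omega⟩ else 1) y : Fin (k + 1) → ℝ) i ^ β i) * (∏ i : Fin (k + 1), (1 - (Fin.insertNth m (if h : 0 < (m : ℕ) then y ⟨(m : ℕ) - 1, by omega⟩ else 1) y : Fin (k + 1) → ℝ) i) ^ γ i) * ∏ i : Fin (k + 1), ∏ j : Fin (k + 1), if i < j then ((Fin.insertNth m (if h : 0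 < (m : ℕ) then y ⟨(m : ℕ) - 1, by omega⟩ else 1) y : Fin (k + 1) → ℝ) i - (Fin.insertNth m (if h : 0 < (m : ℕ) then y ⟨(m : ℕ) - 1, by omega⟩ else 1) y : Fin (k + 1) → ℝ) j) ^ α i j else 1))) rb.domain → (if h : 0 < (m : ℕ) then 0 ≤ α ⟨(m : ℕ) - 1, by omega⟩ m else 0 ≤ γ m) → 0 < ((k : ℤ) + 1 - (m : ℤ)) + (∑ j : Fin (k + 1), if m ≤ j then β j else 0) + (∑ i : Fin (k + 1), ∑ j : Fin (k + 1), if m ≤ i ∧ i < j then α i j else 0) → Literature.NumberTheory.Transcendental.KZ.of R - Literature.NumberTheory.Transcendental.KZ.of rb ∈ Literature.NumberTheory.Transcendental.KZ.relations) → ∀ (k : ℕ) (q : ℚ) (β γ : Fin k → ℤ) (α : Fin k → Fin k → ℤ) (s : Literature.NumberTheory.Transcendental.KZ.IntegralRep k), 4 ≤ k → (∀ i : Fin k, β i = 0 ∨ β i = -1) → (∀ i : Fin k, γ i = 0 ∨ γ i = -1) → (∀ i j : Fin k, α i j = 0 ∨ α i j = -1) → (∑ i : Fin k, β i) + (∑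 i : Fin k, γ i) + (∑ i : Fin k, ∑ j : Fin k, if i < j then α i j else 0) = -(k : ℤ) → s.domain = {t : Fin k → ℝ | (∀ i, 0 < t i) ∧ (∀ i, t i < 1) ∧ StrictAnti t} → Set.EqOn s.integrand (fun t => (q : ℝ) * ((∏ i : Fin k, t i ^ β i) * (∏ i : Fin k, (1 - t i) ^ γ i) * ∏ i : Fin k, ∏ j : Fin k, if i < j then (t i - t j) ^ α i j else 1)) s.domain → ∃ m ∈ AddSubgroup.closure ({x : Literature.NumberTheory.Transcendental.KZ.FormalRep | ∃ (w : ℕ) (ε : Fin w → Bool) (q : ℚ) (s : Literature.NumberTheory.Transcendental.KZ.IntegralRep w), s.domain = {t | (∀ i, 0 < t i) ∧ (∀ i, t i < 1) ∧ StrictAnti t} ∧ Set.EqOn s.integrand (fun t => (q : ℝ) * ∏ i, if ε i then 1 / (1 - t i) else 1 / t i) s.domain ∧ x = Literature.NumberTheory.Transcendental.KZ.of s} ∪ {z : Literature.NumberTheory.Transcendental.KZ.FormalRep | ∃ (q : ℚ) (β γ : Fin k → ℤ) (α : Fin k → Fin k → ℤ) (s : Literature.NumberTheory.Transcendental.KZ.IntegralRep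 k), (∃ p : ℕ, 0 < p ∧ p < k ∧ (∀ i : Fin k, p ≤ (i : ℕ) → γ i = 0) ∧ (∀ i j : Fin k, (i : ℕ) + 1 < p → p ≤ (j : ℕ) → α i j = 0)) ∧ s.domain = {t : Fin k → ℝ | (∀ i, 0 < t i) ∧ (∀ i, t i < 1) ∧ StrictAnti t} ∧ Set.EqOn s.integrand (fun t => (q : ℝ) * ((∏ i : Fin k, t i ^ β i) * (∏ i : Fin k, (1 - t i) ^ γ i) * ∏ i : Fin k, ∏ j : Fin k, if i < j then (t i - t j) ^ α i j else 1)) s.domain ∧ z = Literature.NumberTheory.Transcendental.KZ.of s} ∪ {z : Literature.NumberTheory.Transcendental.KZ.FormalRep | ∃ d : ℕ, d < k ∧ z ∈ {z : Literature.NumberTheory.Transcendental.KZ.FormalRep | ∃ (q : ℚ) (β γ : Fin d → ℤ) (α : Fin d → Fin d → ℤ) (s : Literature.NumberTheory.Transcendental.KZ.IntegralRep d), s.domain = {t : Fin d → ℝ | (∀ i, 0 < t i) ∧ (∀ i, t i < 1) ∧ StrictAnti t} ∧ Set.EqOn s.integrand (fun t => (q : ℝ) * ((∏ i : Fin d, t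 i ^ β i) * (∏ i : Fin d, (1 - t i) ^ γ i) * ∏ i : Fin d, ∏ j : Fin d, if i < j then (t i - t j) ^ α i j else 1)) s.domain ∧ z = Literature.NumberTheory.Transcendental.KZ.of s}}), Literature.NumberTheory.Transcendental.KZ.of s - m ∈ Literature.NumberTheory.Transcendental.KZ.relations  := by
  sorry

/-! ## Composition (sorry-free) -/

/-- Generator-wise reduction modulo `KZ.relations`. -/
def Red (S T : Set KZ.FormalRep) : Prop :=
  ∀ x ∈ S, ∃ c ∈ AddSubgroup.closure T, x - c ∈ KZ.relations

/-- Additive extension of a generator-wise reduction to the generated subgroup. -/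
theorem closure_transfer {S T : Set KZ.FormalRep} (h : Red S T) :
    ∀ x ∈ AddSubgroup.closure S, ∃ c ∈ AddSubgroup.closure T, x - c ∈ KZ.relations := by
  intro x hx
  induction hx using AddSubgroup.closure_induction with
  | mem x hx => exact h x hx
  | zero => exact ⟨0, zero_mem _, by simp⟩
  | add x y _ _ ihx ihy =>
    obtain ⟨m₁, hm₁, h₁⟩ := ihx
    obtain ⟨m₂, hm₂, h₂⟩ := ihy
    refine ⟨m₁ + m₂, add_mem hm₁ hm₂, ?_⟩
    have key := add_mem h₁ h₂
    rwa [show x - m₁ + (y - m₂) = x + y - (m₁ + m₂) by abel] at key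
  | neg x _ ih =>
    obtain ⟨m, hm, h⟩ := ih
    refine ⟨-m, neg_mem hm, ?_⟩
    have key := neg_mem h
    rwa [show -(x - m) = -x - -m by abel] at key

/-- Reductions glue along unions of sources. -/
theorem Red.union {S T U : Set KZ.FormalRep} (h₁ : Red S U) (h₂ : Red T U) : Red (S ∪ T) U := by
  rintro x (hx | hx)
  · exact h₁ x hx
  · exact h₂ x hx

/-- One congruence step: if `x - y ∈ relations` and `y` reduces, so does `x`. -/
theorem red_of_sub_mem {T : Set KZ.FormalRep} {x y : KZ.FormalRep} (hxy : x - y ∈ KZ.relations)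
    (hy : ∃ c ∈ AddSubgroup.closure T, y - c ∈ KZ.relations) :
    ∃ c ∈ AddSubgroup.closure T, x - c ∈ KZ.relations := by
  obtain ⟨c, hc, hyc⟩ := hy
  refine ⟨c, hc, ?_⟩
  have key := add_mem hxy hyc
  rwa [sub_add_sub_cancel] at key

/-- Membership in `relations ⊔ closure T` is the same as reduction onto `T`. -/
theorem red_iff_mem_sup {T : Set KZ.FormalRep} {x : KZ.FormalRep} :
    (∃ c ∈ AddSubgroup.closure T, x - c ∈ KZ.relations) ↔ x ∈ KZ.relations ⊔ AddSubgroup.closure T := by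
  constructor
  · rintro ⟨c, hc, hxc⟩
    exact AddSubgroup.mem_sup.mpr ⟨x - c, hxc, c, hc, by abel⟩
  · intro hx
    obtain ⟨y, hy, c, hc, rfl⟩ := AddSubgroup.mem_sup.mp hx
    exact ⟨c, hc, by simpa using hy⟩

/-- EXIT: word atoms reduce to the crux's word representations (`stub_wordAtomChart`, landed). -/
theorem wAtom_red (k : ℕ) : Red (WAtom k) WordRep := by
  rintro z ⟨q, ε, s, hdom, hint, rfl⟩
  exact stub_wordAtomChart k q ε s hdom hint

/-- A global bound on the number of `+1` coordinates bounds it inside every chord. -/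
theorem card_filter_chord_le {n : ℕ} (lam : Fin n → ℤ) (i j : Fin n)
    (h : (Finset.univ.filter (fun l : Fin n => lam l = 1)).card ≤ 1) :
    (Finset.univ.filter (fun l : Fin n => i ≤ l ∧ l ≤ j ∧ lam l = 1)).card ≤ 1 := by
  refine le_trans (Finset.card_le_card ?_) h
  intro l
  simp only [Finset.mem_filter, Finset.mem_univ, true_and]
  exact fun hl => hl.2.2

/-- SD1-directed atoms of dimension `k` reduce, given the induction hypothesis below `k`. -/
theorem sd1Atom_red (k : ℕ) (IH : ∀ d < k, Red (Atom d) WordRep) : Red (SD1Atom k) WordRep := by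
  rintro z ⟨q, a, e, s, ⟨lam, hlam, hp, hcard, hch, hE⟩, hdom, hint, rfl⟩
  cases k with
  | zero =>
    obtain ⟨p, -⟩ := hp
    exact p.elim0
  | succ k =>
    have hch' : ∀ i j : Fin (k + 1), i ≤ j → e i j ≠ 0 →
        (∑ l : Fin (k + 1), if i ≤ l ∧ l ≤ j then lam l else 0) = 0 ∧
        (Finset.univ.filter (fun l : Fin (k + 1) => i ≤ l ∧ l ≤ j ∧ lam l = 1)).card ≤ 1 :=
      fun i j hij he => ⟨hch i j hij he, card_filter_chord_le lam i j hcard⟩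
    obtain ⟨B, hB, hrel⟩ := stub_torusDescent k q a e lam s hdom hint hlam hp hch' hE
    obtain ⟨m, hm, hBm⟩ := stub_rebaseOne k (q / (((∑ l : Fin (k + 1), lam l * ((a l : ℤ) + 1)) : ℤ) : ℚ)) a e lam B hlam hp hcard hch' hE hB
    have hLE : Red (AtomLE k) WordRep := by
      rintro x ⟨d, hd, hx⟩
      exact IH d (Nat.lt_succ_of_le hd) x hx
    exact red_of_sub_mem hrel (red_of_sub_mem hBm (closure_transfer hLE m hm))

/-- Atoms of dimension `< k` reduce, given the induction hypothesis. -/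
theorem atomLT_red (k : ℕ) (IH : ∀ d < k, Red (Atom d) WordRep) : Red (AtomLT k) WordRep := by
  rintro x ⟨d, hd, hx⟩
  exact IH d hd x hx

/-- Nested atoms of dimension `k` reduce, given the induction hypothesis (Theorem N, landed). -/
theorem nAtom_red (k : ℕ) (IH : ∀ d < k, Red (Atom d) WordRep) : Red (NAtom k) WordRep := by
  rintro z ⟨q, a, e, s, hN, hdom, hint, rfl⟩
  obtain ⟨m, hm, hsm⟩ := stub_nestedReduction k q a e s hdom hint hN
  have h3 : Red (WAtom k ∪ SD1Atom k ∪ AtomLT k) WordRep :=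
    ((wAtom_red k).union (sd1Atom_red k IH)).union (atomLT_red k IH)
  exact red_of_sub_mem hsm (closure_transfer h3 m hm)

/-- LANDED CHAIN IN DIMENSION `≤ 3`: every cubical atom of dimension `k ≤ 3` reduces to words
(strong induction; nested atoms through Theorem N, products through the product split, the rest is
unnested by `stub_unnesting_le_three`). -/
theorem atom_red_le_three : ∀ k : ℕ, k ≤ 3 → Red (Atom k) WordRep := by
  intro k
  induction k using Nat.strong_induction_on with
  | _ k IH =>
    intro hk
    have IH' : ∀ d < k, Red (Atom d) WordRep := fun d hd => IH d hd (by omega)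
    rintro z ⟨q, a, e, s, hdom, hint, rfl⟩
    by_cases hN : (∀ i j i' j' : Fin k, i < j → i' < j' → e i j ≠ 0 → e i' j' ≠ 0 → (i ≤ i' ∧ j' ≤ j) ∨ (i' ≤ i ∧ j ≤ j'))
    · exact nAtom_red k IH' _ ⟨q, a, e, s, hN, hdom, hint, rfl⟩
    · have h4 : Red (NAtom k ∪ SD1Atom k ∪ WAtom k ∪ AtomLT k) WordRep :=
        (((nAtom_red k IH').union (sd1Atom_red k IH')).union (wAtom_red k)).union (atomLT_red k IH')
      obtain ⟨m, hm, hsm⟩ := stub_unnesting_le_three k q a e s hk hdom hint hN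
      exact red_of_sub_mem hsm (closure_transfer h4 m hm)

/-! ### Simplicial monomials are genus-zero inputs of `stub_atomReduction` -/

/-- `x ^ n = x ^ n⁺ / x ^ n⁻` for a non-zero real and an integer exponent. [folklore] -/
theorem zpow_eq_pow_div_pow (x : ℝ) (_hx : x ≠ 0) (n : ℤ) :
    x ^ n = x ^ n.toNat / x ^ (-n).toNat := by
  rcases le_total 0 n with h | h
  · have h1 : (-n).toNat = 0 := Int.toNat_eq_zero.mpr (by omega)
    rw [h1, pow_zero, div_one]
    conv_lhs => rw [← Int.toNat_of_nonneg h]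
    exact zpow_natCast x _
  · have h1 : n.toNat = 0 := Int.toNat_eq_zero.mpr h
    rw [h1, pow_zero, one_div]
    have hn : n = -(((-n).toNat : ℕ) : ℤ) := by
      rw [Int.toNat_of_nonneg (by omega)]; ring
    conv_lhs => rw [hn]
    rw [zpow_neg, zpow_natCast]

/-- On the open ordered simplex a simplicial Laurent monomial is a genus-zero integrand with a
monomial numerator: `q·∏ tᵢ^{βᵢ}(1-tᵢ)^{γᵢ}∏(tᵢ-tⱼ)^{αᵢⱼ} = P(t) / (∏ tᵢ^{bᵢ} ∏ (1-tᵢ)^{cᵢ} ∏ (tᵢ-tⱼ)^{aᵢⱼ})`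
with `b = β⁻`, `c = γ⁻`, `a = α⁻` and `P = q·∏ Xᵢ^{β⁺ᵢ}(1-Xᵢ)^{γ⁺ᵢ}∏(Xᵢ-Xⱼ)^{α⁺ᵢⱼ}`. [folklore] -/
theorem smono_eq_gz {k : ℕ} (q : ℚ) (β γ : Fin k → ℤ) (α : Fin k → Fin k → ℤ)
    (t : Fin k → ℝ) (ht : t ∈ {t : Fin k → ℝ | (∀ i, 0 < t i) ∧ (∀ i, t i < 1) ∧ StrictAnti t}) :
    (q : ℝ) * ((∏ i : Fin k, t i ^ β i) * (∏ i : Fin k, (1 - t i) ^ γ i) * ∏ i : Fin k, ∏ j : Fin k, if i < j then (t i - t j) ^ α i j else 1)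
      = MvPolynomial.aeval t (MvPolynomial.C q * ((∏ i : Fin k, MvPolynomial.X i ^ (β i).toNat) * (∏ i : Fin k, (1 - MvPolynomial.X i) ^ (γ i).toNat) * ∏ i : Fin k, ∏ j : Fin k, if i < j then (MvPolynomial.X i - MvPolynomial.X j) ^ (α i j).toNat else 1) : MvPolynomial (Fin k) ℚ)
        / ((∏ i, t i ^ (fun i => (-β i).toNat) i) * (∏ i, (1 - t i) ^ (fun i => (-γ i).toNat) i) * ∏ i, ∏ j, if i < j then (t i - t j) ^ (fun i j => (-α i j).toNat) i j else 1) := by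
  obtain ⟨h0, h1, hanti⟩ := ht
  have ht0 : ∀ i, t i ≠ 0 := fun i => (h0 i).ne'
  have ht1 : ∀ i, 1 - t i ≠ 0 := fun i => (sub_pos.2 (h1 i)).ne'
  have htij : ∀ i j : Fin k, i < j → t i - t j ≠ 0 := fun i j hij => (sub_pos.2 (hanti hij)).ne'
  -- numerator
  have hnum : MvPolynomial.aeval t (MvPolynomial.C q * ((∏ i : Fin k, MvPolynomial.X i ^ (β i).toNat) * (∏ i : Fin k, (1 - MvPolynomial.X i) ^ (γ i).toNat) * ∏ i : Fin k, ∏ j : Fin k, if i < j then (MvPolynomial.X i - MvPolynomial.X j) ^ (α i j).toNat else 1) : MvPolynomial (Fin k) ℚ)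
      = (q : ℝ) * ((∏ i : Fin k, t i ^ (β i).toNat) * (∏ i : Fin k, (1 - t i) ^ (γ i).toNat) * ∏ i : Fin k, ∏ j : Fin k, if i < j then (t i - t j) ^ (α i j).toNat else 1) := by
    simp only [map_mul, map_prod, map_pow, map_sub, map_one, MvPolynomial.aeval_C, MvPolynomial.aeval_X, eq_ratCast]
    congr 2
    refine Finset.prod_congr rfl fun i _ => Finset.prod_congr rfl fun j _ => ?_
    split_ifs <;> simp [map_pow, map_sub]
  rw [hnum]
  -- split every zpow
  have e1 : (∏ i : Fin k, t i ^ β i) = (∏ i : Fin k, t i ^ (β i).toNat) / ∏ i : Fin k, t i ^ (-β i).toNat := by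
    rw [← Finset.prod_div_distrib]
    exact Finset.prod_congr rfl fun i _ => zpow_eq_pow_div_pow _ (ht0 i) _
  have e2 : (∏ i : Fin k, (1 - t i) ^ γ i) = (∏ i : Fin k, (1 - t i) ^ (γ i).toNat) / ∏ i : Fin k, (1 - t i) ^ (-γ i).toNat := by
    rw [← Finset.prod_div_distrib]
    exact Finset.prod_congr rfl fun i _ => zpow_eq_pow_div_pow _ (ht1 i) _
  have e3 : (∏ i : Fin k, ∏ j : Fin k, if i < j then (t i - t j) ^ α i j else (1:ℝ)) = (∏ i : Fin k, ∏ j : Fin k, if i < j then (t i - t j) ^ (α i j).toNat else (1:ℝ)) / ∏ i : Fin k, ∏ j : Fin k, if i < j then (t i - t j) ^ (-α i j).toNat else (1:ℝ) := by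
    rw [← Finset.prod_div_distrib]
    refine Finset.prod_congr rfl fun i _ => ?_
    rw [← Finset.prod_div_distrib]
    refine Finset.prod_congr rfl fun j _ => ?_
    split_ifs with hij
    · exact zpow_eq_pow_div_pow _ (htij i j hij) _
    · simp
  rw [e1, e2, e3]
  have hB : (∏ i : Fin k, t i ^ (-β i).toNat) ≠ 0 := Finset.prod_ne_zero_iff.2 fun i _ => pow_ne_zero _ (ht0 i)
  have hC : (∏ i : Fin k, (1 - t i) ^ (-γ i).toNat) ≠ 0 := Finset.prod_ne_zero_iff.2 fun i _ => pow_ne_zero _ (ht1 i)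
  have hA : (∏ i : Fin k, ∏ j : Fin k, if i < j then (t i - t j) ^ (-α i j).toNat else (1:ℝ)) ≠ 0 := by
    refine Finset.prod_ne_zero_iff.2 fun i _ => Finset.prod_ne_zero_iff.2 fun j _ => ?_
    split_ifs with hij
    · exact pow_ne_zero _ (htij i j hij)
    · exact one_ne_zero
  field_simp

/-- A convergent simplicial Laurent monomial representation is congruent to a combination of cubical
atoms (`stub_atomReduction`, landed, applied to the genus-zero rewriting `smono_eq_gz`). -/
theorem smono_to_atoms (k : ℕ) (q : ℚ) (β γ : Fin k → ℤ) (α : Fin k → Fin k → ℤ)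
    (s : KZ.IntegralRep k) (hdom : s.domain = {t : Fin k → ℝ | (∀ i, 0 < t i) ∧ (∀ i, t i < 1) ∧ StrictAnti t})
    (hint : EqOn s.integrand (fun t => (q : ℝ) * ((∏ i : Fin k, t i ^ β i) * (∏ i : Fin k, (1 - t i) ^ γ i) * ∏ i : Fin k, ∏ j : Fin k, if i < j then (t i - t j) ^ α i j else 1)) s.domain) :
    ∃ m ∈ AddSubgroup.closure (Atom k), KZ.of s - m ∈ KZ.relations := by
  refine stub_atomReduction k s
    (MvPolynomial.C q * ((∏ i : Fin k, MvPolynomial.X i ^ (β i).toNat) * (∏ i : Fin k, (1 - MvPolynomial.X i) ^ (γ i).toNat) * ∏ i : Fin k, ∏ j : Fin k, if i < j then (MvPolynomial.X i - MvPolynomial.X j) ^ (α i j).toNat else 1))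
    (fun i j => (-α i j).toNat) (fun i => (-β i).toNat) (fun i => (-γ i).toNat) hdom ?_
  intro t ht
  rw [hint ht]
  exact smono_eq_gz q β γ α t (hdom ▸ ht)

/-! ### The induction over the dimension, in simplicial language -/

/-- Every convergent simplicial Laurent monomial representation reduces to words: strong induction on
the dimension.  `k ≤ 3`: through cubical atoms (`smono_to_atoms`) and the landed chain
(`atom_red_le_three`); `k ≥ 4`: `stub_deRham` then `stub_logCore` (fed with `stub_dilationNL`), products through `stub_simplexProductSplit` + `stub_productClosure`, lower
dimensions through the induction hypothesis. -/
theorem smono_red : ∀ k : ℕ, Red (SMono k) WordRep := by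
  intro k
  induction k using Nat.strong_induction_on with
  | _ k IH =>
    rintro z ⟨q, β, γ, α, s, hdom, hint, rfl⟩
    by_cases hk : k ≤ 3
    · obtain ⟨m, hm, hsm⟩ := smono_to_atoms k q β γ α s hdom hint
      exact red_of_sub_mem hsm (closure_transfer (atom_red_le_three k hk) m hm)
    · obtain ⟨m, hm, hsm⟩ := stub_deRham stub_dilationNL k q β γ α s (by omega) hdom hint
      have hW : Red WordRep WordRep := fun x hxw =>
        ⟨x, AddSubgroup.subset_closure hxw, by simp [KZ.relations.zero_mem]⟩
      have hLT : Red (SMonoLT k) WordRep := by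
        rintro x ⟨d, hd, hx⟩
        exact IH d hd x hx
      have hP : Red (SProd k) WordRep := by
        rintro x ⟨q', β', γ', α', s', ⟨p, hp0, hpk, hγ, hα⟩, hdom', hint', rfl⟩
        obtain ⟨d₁, d₂, s₁, s₂, hd₁, hd₂, h₁, h₂, hrel⟩ :=
          stub_simplexProductSplit k p q' β' γ' α' s' hp0 hpk hdom' hint' hγ hα
        have m₁ := red_iff_mem_sup.mp (IH d₁ hd₁ _ h₁)
        have m₂ := red_iff_mem_sup.mp (IH d₂ hd₂ _ h₂)
        have hprod := stub_productClosure d₁ d₂ s₁ s₂ m₁ m₂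
        rw [← KZ.of_mul_of] at hprod
        exact red_of_sub_mem hrel (red_iff_mem_sup.mpr hprod)
      have hLog : Red (SLog k) WordRep := by
        rintro x ⟨q', β', γ', α', s', ⟨hβ, hγ, hα, hsumk⟩, hdom', hint', rfl⟩
        obtain ⟨m', hm', hsm'⟩ :=
          stub_logCore stub_dilationNL k q' β' γ' α' s' (by omega) hβ hγ hα hsumk hdom' hint'
        exact red_of_sub_mem hsm' (closure_transfer ((hW.union hP).union hLT) m' hm')
      exact red_of_sub_mem hsm (closure_transfer ((hLog.union hP).union hLT) m hm)

/-- Every cubical atom reduces to words: `stub_chartBack` + `smono_red`. -/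
theorem atom_red (k : ℕ) : Red (Atom k) WordRep := by
  rintro z ⟨q, a, e, s, hdom, hint, rfl⟩
  obtain ⟨q', β, γ, α, s', hdom', hint', hrel⟩ := stub_chartBack k q a e s hdom hint
  exact red_of_sub_mem hrel (smono_red k _ ⟨q', β, γ, α, s', hdom', hint', rfl⟩)

/-- **The crux, from the stubs.** `LinRedNormalForm.DihedralNormalForm` BY NAME: reduce the
genus-zero input to atoms (`stub_atomReduction`, landed), then every atom to words (`atom_red`);
`WordRep` is verbatim the crux's generator set. -/
theorem DihedralNormalForm_of :
    Summit.KontsevichZagierPeriods.KontsevichZagierPeriods.Theses.LinRedNormalForm.DihedralNormalForm := by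
  intro k r p a b c hdom hint
  obtain ⟨m, hm, hrm⟩ := stub_atomReduction k r p a b c hdom hint
  exact red_of_sub_mem hrm (closure_transfer (atom_red k) m hm)

end Summit.KontsevichZagierPeriods.KontsevichZagierPeriods.Cruxes.DihedralNormalForm.TorusDescent
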